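import Summits.ABC.ABC.Theorems.PrimePowerRadical.Negative.Orders

/-!
# Metric calibration (ii): the higher-level Wieferich mass of an odd prime over the bases

Stub `stub_metric_tail_of` of the line `Sketch` (card `adelic-brjuno-summability`, crux stmt-ABC-1648,
wave 2: the metric calibration of the open stub `stub_wdc`).

With `W_p(q) := wieferichLevel q p = v_p(q^{n} − 1)`, `n := 2(p − 1)`, we prove for an odd prime `p` and
every `Q`: GIVEN the root count `H₁` ("`x^n ≡ 1 (mod p^k)` has at most `n` roots below `p^k`"),
`Σ_{q<Q} (W_p(q) − 2)⁺ ≤ 2Q/p² + 4p²(⌊log_p Q⌋ + 1)`.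

Proof (layer cake). `(W − 2)⁺ = #{j ∈ [2, J) : j < W}` as soon as `W ≤ J`; uniformly in `q < Q` one may
take `J := n(L + 1)`, `L := ⌊log_p Q⌋`, because `p^{W_p(q)} ∣ q^n − 1 < Q^n < p^{(L+1)n}` when `W_p(q) ≥ 1`
(`tail_wieferichLevel_lt`). Swapping the sums, `Σ_{q<Q} (W_p(q) − 2)⁺ = Σ_{j ∈ [2,J)} #{q < Q : j < W_p(q)}`
(`tail_sum_sub_two_eq`). A base `q` on level `j` has `q^n ≡ 1 (mod p^{j+1})`, so
`q ↦ (q mod p^{j+1}, q div p^{j+1})` injects the level set into (roots below `p^{j+1}`) × `[0, Q/p^{j+1}]`,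
whence `#{q < Q : j < W_p(q)} ≤ n (Q/p^{j+1} + 1)` by `H₁` (`tail_card_level_le`). Finally
`Σ_{j ∈ [2,J)} n (Q/p^{j+1} + 1) ≤ nQ · p^{-3}/(1 − 1/p) + nJ = 2Q/p² + 4(p−1)²(L+1)` (geometric series,
`tail_sum_levels_le`).

NOT here: the root count `H₁` itself (stub `stub_card_roots_le`), the level-two count (metric (i),
`stub_metric_levelTwo_of`) and the assembly (`stub_metric_wdc_of`) — the other stubs of wave 2.
-/

noncomputable section

-- `Summit.<Summit>.<Problem>` is the mandated summit-side namespace (CONVENTIONS §2); for the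
-- single-conjunct summit `ABC` the two coincide, so the duplicate `ABC.ABC` is deliberate.
set_option linter.dupNamespace false

namespace Summit.ABC.ABC.Theorems.PrimePowerRadical.Brjuno

open Literature.NumberTheory.DiophantineGeometry UniqueFactorizationMonoid
open Summit.ABC.ABC.Theses.IneffectiveSubspace
open Summit.ABC.ABC.Theorems.PrimePowerRadical.Negative
open scoped BigOperators

/-- On level `j < W_p(q)`: `p^{j+1} ∣ q^{2(p−1)} − 1`, and the latter is nonzero. -/
theorem tail_pow_dvd_of_lt {q p j : ℕ} (h : j < wieferichLevel q p) :
    p ^ (j + 1) ∣ q ^ (2 * (p - 1)) - 1 ∧ q ^ (2 * (p - 1)) - 1 ≠ 0 := by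
  refine ⟨(pow_dvd_pow p (Nat.succ_le_of_lt h)).trans pow_padicValNat_dvd, fun h0 => ?_⟩
  unfold wieferichLevel at h
  rw [h0, padicValNat_zero_right] at h
  exact Nat.not_lt_zero _ h

/-- Uniform height of the layer cake: every base `q < Q` has `W_p(q) < 2(p−1)(⌊log_p Q⌋ + 1)`, since
`p^{W_p(q)} ≤ q^{2(p−1)} − 1 < Q^{2(p−1)} < (p^{⌊log_p Q⌋+1})^{2(p−1)}` when `W_p(q) ≥ 1`. -/
theorem tail_wieferichLevel_lt {p q Q : ℕ} (hp : p.Prime) (hqQ : q < Q) :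
    wieferichLevel q p < 2 * (p - 1) * (Nat.log p Q + 1) := by
  have hp2 := hp.two_le
  rcases Nat.eq_zero_or_pos (wieferichLevel q p) with h0 | hpos
  · rw [h0]
    exact Nat.mul_pos (by omega) (Nat.succ_pos _)
  · obtain ⟨hdvd, hne⟩ := tail_pow_dvd_of_lt (q := q) (p := p) (j := wieferichLevel q p - 1) (by omega)
    rw [Nat.sub_add_cancel hpos] at hdvd
    have h1 : p ^ wieferichLevel q p ≤ q ^ (2 * (p - 1)) - 1 := Nat.le_of_dvd (by omega) hdvd
    have h2 : q ^ (2 * (p - 1)) < Q ^ (2 * (p - 1)) := Nat.pow_lt_pow_left hqQ (by omega)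
    have h3 : Q ^ (2 * (p - 1)) < (p ^ (Nat.log p Q + 1)) ^ (2 * (p - 1)) :=
      Nat.pow_lt_pow_left (Nat.lt_pow_succ_log_self hp.one_lt Q) (by omega)
    rw [← pow_mul, Nat.mul_comm (Nat.log p Q + 1)] at h3
    have h4 : p ^ wieferichLevel q p < p ^ (2 * (p - 1) * (Nat.log p Q + 1)) := by omega
    exact (Nat.pow_lt_pow_iff_right hp.one_lt).mp h4

/-- Layer cake for one base: `(W − 2)⁺` counts the levels `j ∈ [2, J)` with `j < W`, as soon as `W ≤ J`. -/
theorem tail_sub_two_eq_card {W J : ℕ} (hWJ : W ≤ J) :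
    W - 2 = ((Finset.Ico 2 J).filter (fun j => j < W)).card := by
  have h : (Finset.Ico 2 J).filter (fun j => j < W) = Finset.Ico 2 W := by
    ext j
    simp only [Finset.mem_filter, Finset.mem_Ico]
    constructor <;> intro h <;> omega
  rw [h, Nat.card_Ico]

/-- Layer cake summed over the bases, sums swapped:
`Σ_{q<Q} (W_p(q) − 2)⁺ = Σ_{j ∈ [2,J)} #{q < Q : j < W_p(q)}` whenever `W_p(q) ≤ J` for all `q < Q`. -/
theorem tail_sum_sub_two_eq {p Q J : ℕ} (hJ : ∀ q ∈ Finset.range Q, wieferichLevel q p ≤ J) :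
    ∑ q ∈ Finset.range Q, (wieferichLevel q p - 2) =
      ∑ j ∈ Finset.Ico 2 J, ((Finset.range Q).filter (fun q => j < wieferichLevel q p)).card := by
  calc ∑ q ∈ Finset.range Q, (wieferichLevel q p - 2)
      = ∑ q ∈ Finset.range Q, ((Finset.Ico 2 J).filter (fun j => j < wieferichLevel q p)).card :=
        Finset.sum_congr rfl (fun q hq => tail_sub_two_eq_card (hJ q hq))
    _ = ∑ q ∈ Finset.range Q, ∑ j ∈ Finset.Ico 2 J, (if j < wieferichLevel q p then 1 else 0) := by
        simp only [Finset.card_filter]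
    _ = ∑ j ∈ Finset.Ico 2 J, ∑ q ∈ Finset.range Q, (if j < wieferichLevel q p then 1 else 0) :=
        Finset.sum_comm
    _ = ∑ j ∈ Finset.Ico 2 J, ((Finset.range Q).filter (fun q => j < wieferichLevel q p)).card := by
        simp only [Finset.card_filter]

/-- Level count, given the root count `H₁`: at most `2(p−1)·(Q / p^{j+1} + 1)` bases `q < Q` have
`W_p(q) > j`. Such a `q` has `q^{2(p−1)} ≡ 1 (mod p^{j+1})`, so `q ↦ (q mod p^{j+1}, q div p^{j+1})` injects
the level set into (roots of `x^{2(p−1)} ≡ 1` below `p^{j+1}`) × `[0, Q / p^{j+1}]`. -/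
theorem tail_card_level_le
    (H₁ : ∀ p k n : ℕ, p.Prime → p ≠ 2 → 1 ≤ k → 1 ≤ n →
      ((Finset.range (p ^ k)).filter (fun a => a ^ n ≡ 1 [MOD p ^ k])).card ≤ n)
    {p : ℕ} (hp : p.Prime) (hp2 : p ≠ 2) (Q j : ℕ) :
    ((Finset.range Q).filter (fun q => j < wieferichLevel q p)).card ≤
      2 * (p - 1) * (Q / p ^ (j + 1) + 1) := by
  have hm : 0 < p ^ (j + 1) := Nat.pow_pos hp.pos
  have hn1 : 1 ≤ 2 * (p - 1) := by have := hp.two_le; omega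
  have hA := H₁ p (j + 1) (2 * (p - 1)) hp hp2 (Nat.succ_pos j) hn1
  calc ((Finset.range Q).filter (fun q => j < wieferichLevel q p)).card
      ≤ ((Finset.range (p ^ (j + 1))).filter (fun a => a ^ (2 * (p - 1)) ≡ 1 [MOD p ^ (j + 1)]) ×ˢ
          Finset.range (Q / p ^ (j + 1) + 1)).card := by
        refine Finset.card_le_card_of_injOn (fun q => (q % p ^ (j + 1), q / p ^ (j + 1))) ?_ ?_
        · intro q hq
          rw [Finset.mem_coe, Finset.mem_filter, Finset.mem_range] at hq
          obtain ⟨hqQ, hjW⟩ := hq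
          obtain ⟨hdvd, hne⟩ := tail_pow_dvd_of_lt hjW
          simp only [Finset.mem_coe, Finset.mem_product, Finset.mem_filter, Finset.mem_range]
          refine ⟨⟨Nat.mod_lt q hm, ?_⟩, Nat.lt_succ_of_le (Nat.div_le_div_right hqQ.le)⟩
          have h1 : q ^ (2 * (p - 1)) ≡ 1 [MOD p ^ (j + 1)] :=
            ((Nat.modEq_iff_dvd' (by omega)).mpr hdvd).symm
          exact ((Nat.mod_modEq q (p ^ (j + 1))).pow (2 * (p - 1))).trans h1
        · intro q _ q' _ h
          simp only [Prod.mk.injEq] at h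
          rw [← Nat.mod_add_div q (p ^ (j + 1)), ← Nat.mod_add_div q' (p ^ (j + 1)), h.1, h.2]
    _ = ((Finset.range (p ^ (j + 1))).filter (fun a => a ^ (2 * (p - 1)) ≡ 1 [MOD p ^ (j + 1)])).card *
          (Q / p ^ (j + 1) + 1) := by
        rw [Finset.card_product, Finset.card_range]
    _ ≤ 2 * (p - 1) * (Q / p ^ (j + 1) + 1) := Nat.mul_le_mul_right _ hA

/-- The real-variable bookkeeping: with `n := 2(p−1)` and `J := n(L+1)`,
`Σ_{j ∈ [2,J)} n (Q / p^{j+1} + 1) ≤ nQ/(p²(p−1)) + nJ = 2Q/p² + 4(p−1)²(L+1) ≤ 2Q/p² + 4p²(L+1)`. -/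
theorem tail_sum_levels_le {p : ℕ} (hp : 2 ≤ p) (Q L : ℕ) :
    ((∑ j ∈ Finset.Ico 2 (2 * (p - 1) * (L + 1)), 2 * (p - 1) * (Q / p ^ (j + 1) + 1) : ℕ) : ℝ) ≤
      2 * (Q : ℝ) / (p : ℝ) ^ 2 + 4 * (p : ℝ) ^ 2 * (L + 1) := by
  set n := 2 * (p - 1) with hn
  set J := n * (L + 1) with hJ
  have hpR : (0 : ℝ) < p := Nat.cast_pos.mpr (by omega)
  have hp1 : (1 : ℝ) < p := by exact_mod_cast (lt_of_lt_of_le one_lt_two hp)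
  have hx0 : (0 : ℝ) ≤ (p : ℝ)⁻¹ := inv_nonneg.mpr hpR.le
  have hx1 : (p : ℝ)⁻¹ < 1 := inv_lt_one_of_one_lt₀ hp1
  have hnR : (n : ℝ) = 2 * ((p : ℝ) - 1) := by
    rw [hn, Nat.cast_mul, Nat.cast_sub (by omega : 1 ≤ p)]
    norm_num
  have hn0 : (0 : ℝ) ≤ n := Nat.cast_nonneg n
  have hterm : ∀ j ∈ Finset.Ico 2 J, ((n * (Q / p ^ (j + 1) + 1) : ℕ) : ℝ) ≤
      (n : ℝ) * Q * (p : ℝ)⁻¹ * ((p : ℝ)⁻¹) ^ j + n := by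
    intro j _
    have h1 : ((Q / p ^ (j + 1) : ℕ) : ℝ) ≤ (Q : ℝ) * (p : ℝ)⁻¹ * ((p : ℝ)⁻¹) ^ j := by
      calc ((Q / p ^ (j + 1) : ℕ) : ℝ) ≤ (Q : ℝ) / ((p ^ (j + 1) : ℕ) : ℝ) := Nat.cast_div_le
        _ = (Q : ℝ) * (p : ℝ)⁻¹ * ((p : ℝ)⁻¹) ^ j := by
          rw [Nat.cast_pow, div_eq_mul_inv, ← inv_pow, pow_succ]
          ring
    rw [Nat.cast_mul, Nat.cast_add, Nat.cast_one]
    nlinarith [mul_le_mul_of_nonneg_left h1 hn0]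
  have hgeom : ∑ j ∈ Finset.Ico 2 J, ((p : ℝ)⁻¹) ^ j ≤ ((p : ℝ)⁻¹) ^ 2 / (1 - (p : ℝ)⁻¹) :=
    geom_sum_Ico_le_of_lt_one hx0 hx1
  have hcard : ((Finset.Ico 2 J).card : ℝ) ≤ J := by
    rw [Nat.card_Ico]
    exact_mod_cast Nat.sub_le J 2
  have hkey : (n : ℝ) * Q * (p : ℝ)⁻¹ * (((p : ℝ)⁻¹) ^ 2 / (1 - (p : ℝ)⁻¹)) =
      2 * (Q : ℝ) / (p : ℝ) ^ 2 := by
    rw [hnR]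
    have hp0 : (p : ℝ) ≠ 0 := hpR.ne'
    have hp1' : (p : ℝ) - 1 ≠ 0 := sub_ne_zero.mpr hp1.ne'
    field_simp
  have hJn : (J : ℝ) * n ≤ 4 * (p : ℝ) ^ 2 * (L + 1) := by
    rw [hJ, Nat.cast_mul, Nat.cast_add, Nat.cast_one, hnR]
    have h0 : (0 : ℝ) ≤ (L : ℝ) + 1 := by positivity
    have h1 : (2 * ((p : ℝ) - 1)) * (2 * ((p : ℝ) - 1)) ≤ 4 * (p : ℝ) ^ 2 := by nlinarith
    calc 2 * ((p : ℝ) - 1) * ((L : ℝ) + 1) * (2 * ((p : ℝ) - 1))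
        = (2 * ((p : ℝ) - 1)) * (2 * ((p : ℝ) - 1)) * ((L : ℝ) + 1) := by ring
      _ ≤ 4 * (p : ℝ) ^ 2 * ((L : ℝ) + 1) := mul_le_mul_of_nonneg_right h1 h0
  rw [Nat.cast_sum]
  calc ∑ j ∈ Finset.Ico 2 J, ((n * (Q / p ^ (j + 1) + 1) : ℕ) : ℝ)
      ≤ ∑ j ∈ Finset.Ico 2 J, ((n : ℝ) * Q * (p : ℝ)⁻¹ * ((p : ℝ)⁻¹) ^ j + n) :=
        Finset.sum_le_sum hterm
    _ = (n : ℝ) * Q * (p : ℝ)⁻¹ * ∑ j ∈ Finset.Ico 2 J, ((p : ℝ)⁻¹) ^ j +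
          (Finset.Ico 2 J).card * n := by
        rw [Finset.sum_add_distrib, ← Finset.mul_sum, Finset.sum_const, nsmul_eq_mul]
    _ ≤ (n : ℝ) * Q * (p : ℝ)⁻¹ * (((p : ℝ)⁻¹) ^ 2 / (1 - (p : ℝ)⁻¹)) + J * n := by
        have hc0 : (0 : ℝ) ≤ (n : ℝ) * Q * (p : ℝ)⁻¹ := by positivity
        exact add_le_add (mul_le_mul_of_nonneg_left hgeom hc0) (mul_le_mul_of_nonneg_right hcard hn0)
    _ = 2 * (Q : ℝ) / (p : ℝ) ^ 2 + J * n := by rw [hkey]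
    _ ≤ 2 * (Q : ℝ) / (p : ℝ) ^ 2 + 4 * (p : ℝ) ^ 2 * (L + 1) := by linarith [hJn]

/-- **stub_metric_tail_of (metric (ii)).** For an odd prime `p`: the higher-level Wieferich mass of the
bases below `Q`, `Σ_{q<Q} (W_p(q) − 2)⁺ ≤ 2Q/p² + 4p²(⌊log_p Q⌋ + 1)` — given the root count `H₁`
(`x^n ≡ 1 (mod p^k)` has at most `n` roots below `p^k`). Layer cake over the levels `j ≥ 2`
(`tail_sum_sub_two_eq`), the level count `tail_card_level_le`, and the geometric series
`tail_sum_levels_le`. -/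
theorem stub_metric_tail_of
    (H₁ : ∀ p k n : ℕ, p.Prime → p ≠ 2 → 1 ≤ k → 1 ≤ n →
      ((Finset.range (p ^ k)).filter (fun a => a ^ n ≡ 1 [MOD p ^ k])).card ≤ n)
    {p : ℕ} (hp : p.Prime) (hp2 : p ≠ 2) (Q : ℕ) :
    (∑ q ∈ Finset.range Q, ((wieferichLevel q p - 2 : ℕ) : ℝ)) ≤
      2 * (Q : ℝ) / (p : ℝ) ^ 2 + 4 * (p : ℝ) ^ 2 * (Nat.log p Q + 1) := by
  have hnat : ∑ q ∈ Finset.range Q, (wieferichLevel q p - 2) ≤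
      ∑ j ∈ Finset.Ico 2 (2 * (p - 1) * (Nat.log p Q + 1)),
        2 * (p - 1) * (Q / p ^ (j + 1) + 1) := by
    rw [tail_sum_sub_two_eq (J := 2 * (p - 1) * (Nat.log p Q + 1))
      (fun q hq => (tail_wieferichLevel_lt hp (Finset.mem_range.mp hq)).le)]
    exact Finset.sum_le_sum (fun j _ => tail_card_level_le H₁ hp hp2 Q j)
  calc (∑ q ∈ Finset.range Q, ((wieferichLevel q p - 2 : ℕ) : ℝ))
      = ((∑ q ∈ Finset.range Q, (wieferichLevel q p - 2) : ℕ) : ℝ) := by rw [Nat.cast_sum]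
    _ ≤ ((∑ j ∈ Finset.Ico 2 (2 * (p - 1) * (Nat.log p Q + 1)),
          2 * (p - 1) * (Q / p ^ (j + 1) + 1) : ℕ) : ℝ) := Nat.cast_le.mpr hnat
    _ ≤ 2 * (Q : ℝ) / (p : ℝ) ^ 2 + 4 * (p : ℝ) ^ 2 * (Nat.log p Q + 1) :=
        tail_sum_levels_le hp.two_le Q (Nat.log p Q)

end Summit.ABC.ABC.Theorems.PrimePowerRadical.Brjuno

end
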